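import Summits.RiemannHypothesis.RiemannHypothesis.Theorems.WeilFormatCCinfExactTables
import HarnessLib

/-!
# Format C, design C∞ (E2 data side): glue for claimed tables — transpose, row-append, padding, diagonal, absolute values

Route context: Fourier–Galerkin / Schur-complement certificates of Weil positivity on a window ("format C", C∞ door;
cell memo `run/shared/lean/pub/rh-explicit/rh-explicit-weil-2/gen15/E2-PLAN-v2.md` §6 and the gen16 pipeline spec
`rh-explicit-weil-2/gen16/E2F-CERT-PIPELINE.md`; supporting stmt-RiemannHypothesis-0098; seat rh-explicit-weil-2).

The stages of the composite certificate evaluator exchange `CinfExact.TabNear f n k c ρ Z` facts.  Between stages the same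
real table is needed in another LAYOUT (transposed for `CinfStageL`, x-rows and β-rows glued for `CinfStageT`, padded or
put on a diagonal for the final assembly, or through `|·|` for the remainder weights).  This file provides these
re-layouts, each from an EXACT kernel check on the integer tables where one is needed:

* `CinfGlue.checkTranspose` + `TabNear.transpose_of_check` — `TabNear (fun t i ↦ f i t) k n c ρ ZT` from `TabNear f n k c ρ Z`
  and `ZT[t][i] = Z[i][t]`;
* `TabNear.append_rows` — glue `n₁` rows and `n₂` rows (same width/scale/radius) into the table `Z₁ ++ Z₂` of the function
  `fun p ↦ if p < n₁ then f₁ p else f₂ (p − n₁)` (requires `Z₁.length = n₁`);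
* `TabNear.of_fin` — a `Fin r`-indexed family read as an `ℕ`-indexed table through `CinfGlue.finN`;
* `TabNear.abs` — `TabNear (fun i j ↦ |f i j|) …` with the table of absolute values and the same radius;
* `CinfGlue.diagZ` + `TabNear.diag` — a one-index claim `VecNear g n c ρ V` as the diagonal table of
  `fun p q ↦ if p = q then g p else 0`;
* `TabNear.mono_scale` — rescaling a claim to a coarser radius bookkeeping (`ρ ≤ ρ'`, re-export of `TabNear.mono`);
* `CinfGlue.uf / flat / sum_flatten` — the family index `Fin 4 × Fin D` flattened to `f = y.2 + D·y.1 < 4D`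
  (`Σ_y φ y = Σ_{f<4D} flat φ f`), shared by the sector glue files.

List bookkeeping only; standard axioms; no RH claim.
-/

set_option autoImplicit false
-- `Summit.RiemannHypothesis.RiemannHypothesis.…` is the layout-mandated namespace (summit = problem name).
set_option linter.dupNamespace false

open Finset

namespace Summit.RiemannHypothesis.RiemannHypothesis.Theorems.WeilFormatC

open Literature.NumberTheory.LFunctions (PsdDyadic.getMZ)

namespace CinfGlue

/-! ## Flattening the family index `Fin 4 × Fin D` -/

/-- Un-flattening `f < 4D` to the family index (`f = y.2 + D·y.1`, `finProdFinEquiv`). -/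
def uf (D f : ℕ) (h : f < 4 * D) : Fin 4 × Fin D := finProdFinEquiv.symm ⟨f, h⟩

/-- A family-indexed function read on the flattened index (`0` beyond `4D`). -/
noncomputable def flat (D : ℕ) (φ : Fin 4 × Fin D → ℝ) (f : ℕ) : ℝ := if h : f < 4 * D then φ (uf D f h) else 0

/-- Reading `flat` below `4D`. -/
theorem flat_of_lt (D : ℕ) (φ : Fin 4 × Fin D → ℝ) {f : ℕ} (h : f < 4 * D) : flat D φ f = φ (uf D f h) := by
  simp only [flat, dif_pos h]

/-- **Flattening**: `Σ_y φ y = Σ_{f<4D} flat φ f`. -/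
theorem sum_flatten (D : ℕ) (φ : Fin 4 × Fin D → ℝ) : ∑ y, φ y = ∑ f ∈ range (4 * D), flat D φ f := by
  have h1 : ∑ y, φ y = ∑ g : Fin (4 * D), φ (finProdFinEquiv.symm g) :=
    (Equiv.sum_comp finProdFinEquiv.symm φ).symm
  rw [h1, ← Fin.sum_univ_eq_sum_range (fun f ↦ flat D φ f)]
  refine Finset.sum_congr rfl fun g _ ↦ ?_
  simp only [flat, dif_pos g.isLt, uf, Fin.eta]

/-! ## Transpose -/

/-- Exact transpose check: `ZT[t][i] = Z[i][t]` for `i < n`, `t < k`. -/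
def checkTranspose (Z ZT : List (List ℤ)) (n k : ℕ) : Bool :=
  CinfExact.allFromTo 0 n fun i ↦ CinfExact.allFromTo 0 k fun t ↦
    decide (PsdDyadic.getMZ ZT t i = PsdDyadic.getMZ Z i t)

/-- **Transposed claim** from an exact transpose check. -/
theorem TabNear.transpose_of_check {f : ℕ → ℕ → ℝ} {n k c ρ : ℕ} {Z ZT : List (List ℤ)}
    (h : CinfExact.TabNear f n k c ρ Z) (hT : checkTranspose Z ZT n k = true) :
    CinfExact.TabNear (fun t i ↦ f i t) k n c ρ ZT := by
  refine ⟨fun t ht i hi ↦ ?_⟩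
  have h1 := CinfExact.allFromTo_spec (CinfExact.allFromTo_spec hT i (Nat.zero_le _) (by simpa using hi))
    t (Nat.zero_le _) (by simpa using ht)
  rw [decide_eq_true_eq] at h1
  rw [h1]
  exact h.out i hi t ht

/-! ## Gluing rows -/

/-- `getMZ` of an appended table, first part. -/
theorem getMZ_append_left {Z₁ Z₂ : List (List ℤ)} {p : ℕ} (hp : p < Z₁.length) (t : ℕ) :
    PsdDyadic.getMZ (Z₁ ++ Z₂) p t = PsdDyadic.getMZ Z₁ p t := by
  simp only [PsdDyadic.getMZ, List.getD_eq_getElem?_getD, List.getElem?_append_left hp]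

/-- `getMZ` of an appended table, second part. -/
theorem getMZ_append_right {Z₁ Z₂ : List (List ℤ)} {p : ℕ} (hp : Z₁.length ≤ p) (t : ℕ) :
    PsdDyadic.getMZ (Z₁ ++ Z₂) p t = PsdDyadic.getMZ Z₂ (p - Z₁.length) t := by
  simp only [PsdDyadic.getMZ, List.getD_eq_getElem?_getD, List.getElem?_append_right hp]

/-- **Glued rows**: `n₁` claimed rows of `f₁` followed by `n₂` claimed rows of `f₂` form the claimed table `Z₁ ++ Z₂` of the
glued function (x-rows first, as the stages index the certificate matrix). -/
theorem TabNear.append_rows {f₁ f₂ : ℕ → ℕ → ℝ} {n₁ n₂ k c ρ : ℕ} {Z₁ Z₂ : List (List ℤ)}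
    (h₁ : CinfExact.TabNear f₁ n₁ k c ρ Z₁) (h₂ : CinfExact.TabNear f₂ n₂ k c ρ Z₂) (hlen : Z₁.length = n₁) :
    CinfExact.TabNear (fun p t ↦ if p < n₁ then f₁ p t else f₂ (p - n₁) t) (n₁ + n₂) k c ρ (Z₁ ++ Z₂) := by
  refine ⟨fun p hp t ht ↦ ?_⟩
  by_cases hp1 : p < n₁
  · rw [if_pos hp1, getMZ_append_left (by rw [hlen]; exact hp1)]
    exact h₁.out p hp1 t ht
  · rw [if_neg hp1, getMZ_append_right (by rw [hlen]; omega), hlen]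
    exact h₂.out (p - n₁) (by omega) t ht

/-! ## `Fin`-indexed families as `ℕ`-indexed tables -/

/-- A `Fin r`-indexed family of rows read with an `ℕ` row index (`0` beyond `r`). -/
noncomputable def finN {r : ℕ} (f : Fin r → ℕ → ℝ) (j t : ℕ) : ℝ :=
  if h : j < r then f ⟨j, h⟩ t else 0

/-- Reading `finN` at a `Fin` index. -/
theorem finN_apply {r : ℕ} (f : Fin r → ℕ → ℝ) (j : Fin r) (t : ℕ) : finN f j t = f j t := by
  simp [finN, j.isLt]

/-- **`Fin`-indexed claim**: a per-`Fin` statement gives the `TabNear` of `finN f`. -/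
theorem TabNear.of_fin {r : ℕ} {f : Fin r → ℕ → ℝ} {k c ρ : ℕ} {Z : List (List ℤ)}
    (h : ∀ (j : Fin r), ∀ t < k, |f j t - (PsdDyadic.getMZ Z j t : ℝ) / 2 ^ c| ≤ (ρ : ℝ) / 2 ^ c) :
    CinfExact.TabNear (finN f) r k c ρ Z := by
  refine ⟨fun j hj t ht ↦ ?_⟩
  rw [finN, dif_pos hj]
  exact h ⟨j, hj⟩ t ht

/-! ## Absolute values -/

/-- `| |x| − |y| | ≤ |x − y|` transports a claim through absolute values (table of `|Z[i][j]|`, same radius). -/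
theorem TabNear.abs {f : ℕ → ℕ → ℝ} {n k c ρ : ℕ} {Z : List (List ℤ)} (h : CinfExact.TabNear f n k c ρ Z) :
    CinfExact.TabNear (fun i j ↦ |f i j|) n k c ρ (Z.map fun row ↦ row.map fun z ↦ |z|) := by
  refine ⟨fun i hi j hj ↦ ?_⟩
  have h1 := h.out i hi j hj
  have e : (PsdDyadic.getMZ (Z.map fun row ↦ row.map fun z ↦ |z|) i j : ℝ) = |(PsdDyadic.getMZ Z i j : ℝ)| := by
    simp only [PsdDyadic.getMZ, List.getD_eq_getElem?_getD, List.getElem?_map]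
    cases Z[i]? with
    | none => simp
    | some row =>
        simp only [Option.map_some, Option.getD_some, List.getElem?_map]
        cases row[j]? with
        | none => simp
        | some z => simp
  rw [e]
  have h2 : (0 : ℝ) < 2 ^ c := by positivity
  have e2 : |(PsdDyadic.getMZ Z i j : ℝ)| / 2 ^ c = |(PsdDyadic.getMZ Z i j : ℝ) / 2 ^ c| := by
    rw [abs_div, abs_of_pos h2]
  rw [e2]
  exact (abs_abs_sub_abs_le_abs_sub _ _).trans h1

/-! ## Diagonal tables from one-index claims -/

/-- The `n × n` diagonal integer table of a list. -/
def diagZ (V : List ℤ) (n : ℕ) : List (List ℤ) :=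
  (List.range n).map fun p ↦ (List.range n).map fun q ↦ if p = q then V.getD p 0 else 0

/-- Entries of `diagZ`. -/
theorem getMZ_diagZ (V : List ℤ) {n p q : ℕ} (hp : p < n) (hq : q < n) :
    PsdDyadic.getMZ (diagZ V n) p q = if p = q then V.getD p 0 else 0 := by
  simp only [PsdDyadic.getMZ, diagZ, List.getD_eq_getElem?_getD, List.getElem?_map, List.getElem?_range hp,
    Option.map_some, Option.getD_some, List.getElem?_range hq]

/-- **Diagonal claim**: `VecNear g n c ρ V` gives the claimed diagonal table of `fun p q ↦ if p = q then g p else 0`. -/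
theorem TabNear.diag {g : ℕ → ℝ} {n c ρ : ℕ} {V : List ℤ} (h : CinfExact.VecNear g n c ρ V) :
    CinfExact.TabNear (fun p q ↦ if p = q then g p else 0) n n c ρ (diagZ V n) := by
  refine ⟨fun p hp q hq ↦ ?_⟩
  rw [getMZ_diagZ V hp hq]
  by_cases hpq : p = q
  · rw [if_pos hpq, if_pos hpq]
    exact h.out p hp
  · rw [if_neg hpq, if_neg hpq]
    simp only [Int.cast_zero, zero_div, sub_zero, abs_zero]
    positivity

/-! ## Exact tables as claims, coarser radii -/

/-- An exact dyadic table is a claim of radius `0` at its own scale (re-export for the pipeline's vocabulary). -/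
theorem TabNear.exact {n k c : ℕ} (Z : List (List ℤ)) :
    CinfExact.TabNear (fun i j ↦ (PsdDyadic.getMZ Z i j : ℝ) / 2 ^ c) n k c 0 Z :=
  CinfExact.TabNear.of_eq fun _ _ _ _ ↦ rfl

/-- Coarser radius. -/
theorem TabNear.mono_scale {f : ℕ → ℕ → ℝ} {n k c ρ ρ' : ℕ} {Z : List (List ℤ)} (h : CinfExact.TabNear f n k c ρ Z)
    (hρ : ρ ≤ ρ') : CinfExact.TabNear f n k c ρ' Z :=
  h.mono hρ

/-- Restricting a claim to fewer rows / columns. -/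
theorem TabNear.restrict {f : ℕ → ℕ → ℝ} {n k n' k' c ρ : ℕ} {Z : List (List ℤ)} (h : CinfExact.TabNear f n k c ρ Z)
    (hn : n' ≤ n) (hk : k' ≤ k) : CinfExact.TabNear f n' k' c ρ Z :=
  ⟨fun i hi j hj ↦ h.out i (by omega) j (by omega)⟩

/-- Changing the enclosed function by pointwise equality on the index range. -/
theorem TabNear.congr {f g : ℕ → ℕ → ℝ} {n k c ρ : ℕ} {Z : List (List ℤ)} (h : CinfExact.TabNear f n k c ρ Z)
    (hfg : ∀ i < n, ∀ j < k, f i j = g i j) : CinfExact.TabNear g n k c ρ Z :=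
  ⟨fun i hi j hj ↦ hfg i hi j hj ▸ h.out i hi j hj⟩

end CinfGlue

end Summit.RiemannHypothesis.RiemannHypothesis.Theorems.WeilFormatC
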